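import Summits.RiemannHypothesis.RiemannHypothesis.Theorems.GroundBartaEvenWinsBeyondArchDeflationSigmaPanels
import HarnessLib

/-!
# RiemannHypothesis / GroundBarta — rung 4 (`EvenWinsBeyondArch`, stmt-RiemannHypothesis-18807 / 18085):
# the deflated Temple L-side, XVII d — panel glue: flagged prime terms, window membership from enclosures, the `M_c`-free residual

Helper file (`--supports stmt-RiemannHypothesis-18807`), RH-free, Mathlib + landed tree files only, no facts.  Prover B,
speedrun unit `sr-gb-rung-b` (gen 4).

Bookkeeping between the TRUE real residual of file XV (`dt_residual_real`: window indicators `𝟙_{[-c,c]}`, the exact killing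
constant `M_c`, the real coefficient matrix `W`) and the FLAGGED, `M_c`-FREE form that the kernel Taylor models of files XVI–XVII c
enclose:
* `dt_primeSlotFn` — the prime term with Boolean flags in place of the window indicators, and `dt_primeSlotFn_eq_indicator`:
  on a panel where the flags agree with the memberships of `y ∓ L`, the two coincide;
* `dt_mem_window_of_bounds` / `dt_not_mem_window_of_lt` / `dt_not_mem_window_of_gt` — window membership of `y₀ + ρ ∓ L` for ALL
  `|ρ| ≤ h` from rational comparisons against an enclosure `Llo ≤ L ≤ Lhi` (what the certificate decides);
* `dt_residual_real_shift` — choosing `W_il = W̃_il + [l = i](M̃ − M_c)` turns the residual into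
  `Φ⁰_i(y) − M̃ g_i(y) − Σ_l W̃_il g_l(y)` with ANY rational stand-in `M̃` for the killing constant (the sigma criterion leaves `W` free,
  so the R-layer never needs an enclosure of `M_c`).

References: E. Bombieri, Rend. Mat. Acc. Lincei (9) 11 (2000) Thm 2 [Bombieri2000Weil].
-/

set_option linter.dupNamespace false

noncomputable section

open MeasureTheory Set Filter Finset
open scoped Topology BigOperators

namespace Summit.RiemannHypothesis.RiemannHypothesis.Theorems.EvenWinsBeyondArch

open Literature.NumberTheory.LFunctions
open Literature.Analysis.ValidatedNumerics.ExpPoly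

/-! ## Flagged prime terms -/

/-- The prime term with Boolean flags: `w·(2g(y) − [a] g(y−L) − [b] g(y+L))`, `g = Poly.eval gp`. -/
def dt_primeSlotFn (gp : Poly) (w L : ℝ) (a b : Bool) (y : ℝ) : ℝ :=
  w * (2 * Poly.eval gp y - (if a then Poly.eval gp (y - L) else 0) - (if b then Poly.eval gp (y + L) else 0))

/-- **Flags = memberships ⇒ flagged term = true term.** [cite: Bombieri2000Weil, Thm 2 (prime term)] -/
theorem dt_primeSlotFn_eq_indicator (gp : Poly) (w L : ℝ) {a b : Bool} {c y : ℝ}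
    (ha : a = true ↔ y - L ∈ Icc (-c) c) (hb : b = true ↔ y + L ∈ Icc (-c) c) :
    dt_primeSlotFn gp w L a b y =
      w * (2 * Poly.eval gp y - (Icc (-c) c).indicator (fun x ↦ Poly.eval gp x) (y - L) -
        (Icc (-c) c).indicator (fun x ↦ Poly.eval gp x) (y + L)) := by
  unfold dt_primeSlotFn
  congr 2
  · congr 1
    cases a with
    | true => rw [indicator_of_mem (ha.1 rfl)]; rfl
    | false =>
        have : y - L ∉ Icc (-c) c := fun hm ↦ by simpa using ha.2 hm
        rw [indicator_of_notMem this]; rfl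
  · cases b with
    | true => rw [indicator_of_mem (hb.1 rfl)]; rfl
    | false =>
        have : y + L ∉ Icc (-c) c := fun hm ↦ by simpa using hb.2 hm
        rw [indicator_of_notMem this]; rfl

/-! ## Window membership on a whole panel from an enclosure of the shift -/

/-- If `−c ≤ y₀ − h + slo` and `y₀ + h + shi ≤ c` with `slo ≤ s ≤ shi`, then `y₀ + ρ + s ∈ [−c, c]` for all `|ρ| ≤ h`
(use `s = −L` or `s = L`). -/
theorem dt_mem_window_of_bounds {c y0 h s slo shi : ℝ} (hs1 : slo ≤ s) (hs2 : s ≤ shi)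
    (hlo : -c ≤ y0 - h + slo) (hhi : y0 + h + shi ≤ c) {ρ : ℝ} (hρ : |ρ| ≤ h) : y0 + ρ + s ∈ Icc (-c) c := by
  have := abs_le.1 hρ
  exact ⟨by linarith, by linarith⟩

/-- If `y₀ + h + shi < −c` (`s ≤ shi`) then `y₀ + ρ + s ∉ [−c, c]` for all `|ρ| ≤ h`. -/
theorem dt_not_mem_window_of_lt {c y0 h s shi : ℝ} (hs2 : s ≤ shi) (hlt : y0 + h + shi < -c) {ρ : ℝ}
    (hρ : |ρ| ≤ h) : y0 + ρ + s ∉ Icc (-c) c := by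
  have := abs_le.1 hρ
  intro hm
  linarith [hm.1]

/-- If `c < y₀ − h + slo` (`slo ≤ s`) then `y₀ + ρ + s ∉ [−c, c]` for all `|ρ| ≤ h`. -/
theorem dt_not_mem_window_of_gt {c y0 h s slo : ℝ} (hs1 : slo ≤ s) (hgt : c < y0 - h + slo) {ρ : ℝ}
    (hρ : |ρ| ≤ h) : y0 + ρ + s ∉ Icc (-c) c := by
  have := abs_le.1 hρ
  intro hm
  linarith [hm.2]

/-! ## The `M_c`-free residual -/

/-- **Shifting the free coefficient matrix absorbs the killing constant.**  With `W_il = W̃_il + [l = i](M̃ − M_c)`,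
for `y ∈ [0, c)` the residual `(F_i − Σ_l W_il v_l)(y)` equals the real window image WITHOUT its killing term, minus `M̃ g_i(y)`,
minus `Σ_l W̃_il g_l(y)`.  [cite: Bombieri2000Weil, Thm 2] -/
theorem dt_residual_real_shift {c : ℝ} (hc : 0 < c) {k : ℕ} {g : Fin k → ℝ → ℝ} (hg : ∀ i, ContDiff ℝ 2 (g i))
    {v F : Fin k → ℝ → ℂ} (hv : ∀ i x, v i x = (((Icc (-c) c).indicator (g i) x : ℝ) : ℂ))
    (hF : ∀ i y, F i y = (Icc (-c) c).indicator (fun y ↦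
        2 * (∫ x, v i x * (Real.cosh (x / 2) : ℂ)) * (Real.cosh (y / 2) : ℂ) -
          2 * (∫ x, v i x * (Real.sinh (x / 2) : ℂ)) * (Real.sinh (y / 2) : ℂ) +
        (∑ n ∈ weilPrimeIndex c, (((ArithmeticFunction.vonMangoldt n : ℝ) / Real.sqrt n : ℝ) : ℂ) *
          (2 * v i y - v i (y - Real.log n) - v i (y + Real.log n))) +
        ∫ t in Ioi 0, (weilArchDensity t : ℂ) * (2 * v i y - v i (y - t) - v i (y + t))) y -
      (weilMarkovConstant c : ℂ) * v i y)
    (Wt : Fin k → Fin k → ℝ) (Mt : ℝ) (i : Fin k) {y : ℝ} (hy : y ∈ Ico 0 c) :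
    (F i - ∑ l, (Wt i l + if l = i then Mt - weilMarkovConstant c else 0) • v l) y =
      ((2 * (∫ x in (-c)..c, g i x * Real.cosh (x / 2)) * Real.cosh (y / 2) -
          2 * (∫ x in (-c)..c, g i x * Real.sinh (x / 2)) * Real.sinh (y / 2) +
        (∑ n ∈ weilPrimeIndex c, ((ArithmeticFunction.vonMangoldt n : ℝ) / Real.sqrt n) *
          (2 * g i y - (Icc (-c) c).indicator (g i) (y - Real.log n) -
            (Icc (-c) c).indicator (g i) (y + Real.log n))) +
        ((∫ t in Ioc 0 (c - y), weilArchDensityG t * ((2 * g i y - g i (y - t) - g i (y + t)) / t)) +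
          (∫ t in Ioc (c - y) (c + y), weilArchDensityG t * ((g i y - g i (y - t)) / t)) +
          g i y * ((∫ t in Ioi (c - y), weilArchDensity t) + ∫ t in Ioi (c + y), weilArchDensity t)) -
        Mt * g i y - ∑ l, Wt i l * g l y : ℝ) : ℂ) := by
  rw [dt_residual_real (W := fun i l ↦ Wt i l + if l = i then Mt - weilMarkovConstant c else 0) hc hg hv hF i hy]
  have hsum : ∑ l, (Wt i l + if l = i then Mt - weilMarkovConstant c else 0) * g l y =
      (∑ l, Wt i l * g l y) + (Mt - weilMarkovConstant c) * g i y := by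
    simp_rw [add_mul, Finset.sum_add_distrib, ite_mul, zero_mul]
    rw [Finset.sum_ite_eq' Finset.univ i, if_pos (Finset.mem_univ i)]
  rw [hsum]
  push_cast
  ring

end Summit.RiemannHypothesis.RiemannHypothesis.Theorems.EvenWinsBeyondArch

end
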